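import Literature.MeasureTheory.Group.AddFundamentalDomainLatticeSum
import Literature.NumberTheory.Automorphic.AdelicLatticeEscapeBoxCount
import Literature.NumberTheory.Automorphic.AdelicFundamentalDomain
import Literature.NumberTheory.Automorphic.AdelicPoissonScaled
import HarnessLib

/-!
# The lattice sum `Σ_{ξ ∈ K} F(a ξ + s)` along a dilated and shifted adelic line: the CUSP bound
# (lattice sum minus normalised integral ≤ oscillation × module), the COUNT bound (uniformly
# `O(max(1, ‖a‖⁻¹))` terms, every shift) and the LOW regime (the `ξ ≠ 0` part is empty)
(Rogawski, *Automorphic Representations of Unitary Groups in Three Variables* (1990), §7.2, proof of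
Prop. 7.2.2, p. 95 «absolutely integrable for every `T`»; Arthur, *A trace formula for reductive groups I*,
Duke Math. J. 45 (1978), §8; Weil, *Adeles and algebraic groups* (1982), Chap. I n° 12 Lemme 5)

Topic `NumberTheory/Automorphic`; namespace `Literature.NumberTheory.Automorphic`. Proof file (theorems
only: no definition, no named fact, no instance, no `sorry`); generic number field `K`,
`𝔸 = AdeleRing (𝓞 K) K`, lattice `K ≤ 𝔸` (`AdeleRing.principalSubgroup`), Tate's fundamental domain
`D = adeleFundamentalDomain K`, an idele `a` acting by `x ↦ a x` with module `‖a‖ = ideleNorm a`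
(★ `AdeleRing.addHaar_smul_eq_ideleNorm_mul`), an additive Haar measure `μ` on `𝔸`.

This is the `x`-LINE twin (full adeles `𝔸_E`, lattice `E`, every coset of `B_γ(F)∖B(F) ≅ E` kept —
no removal of `ξ = 0`) of ★ B-p04 `TraceZeroCentreLineLatticeSum` (the centre line `𝔸_E⁻`, lattice
`E⁻`), both being instances of Weil's Riemann-sum estimate ★ `AddFundamentalDomainLatticeSum` §7:

* §1 plumbing: `finite_setOf_algebraMap_mem` (`K` meets compacta finitely — ★ box count),
  `tsum_comp_units_mul` (`r ∈ Kˣ` permutes `K`), `integral_comp_units_mul_add`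
  (`∫ F(a x + s) dμ = ‖a‖⁻¹ ∫ F dμ`), `measure_preimage_units_mul` (`μ(a⁻¹ X) = ‖a‖⁻¹ μ X`);
* §2 **CUSP** `exists_const_norm_tsum_line_sub_smul_integral_le`: for compacta `C_X, S₀, L₀ ⊆ 𝔸`
  there is ONE constant `D'` with
  `‖Σ_{ξ ∈ K} F(a ξ + s) − μ(D)⁻¹ ‖a‖⁻¹ ∫ F dμ‖ ≤ ω · ‖a‖⁻¹ · D'`
  for every measurable `F` bounded by `M` and vanishing off `C_X`, every `s ∈ S₀`, every idele `a`
  and `r ∈ Kˣ` with `a r ∈ L₀`, and every modulus `ω` of oscillation of `F` over the cells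
  `x + a r · D` — in the cusp `‖a‖ → 0` the lattice sum is its Riemann integral up to
  `oscillation × ‖a‖⁻¹`;
* §3 **COUNT** `exists_const_summable_norm_tsum_line_le`: `‖Σ_{ξ ∈ K} F(a ξ + s)‖ ≤ M · c₁ · max(1, ‖a‖⁻¹)`
  for EVERY idele `a` and EVERY shift `s` (★ (P5) `exists_ncard_mul_algebraMap_add_mem_le`), with the
  summability of the lattice sum — the MIDDLE regime for free;
* §4 **LOW** `exists_forall_tsum_line_ne_zero_eq_zero`: for `‖a‖` large and `s ∈ S₀` the terms
  `ξ ≠ 0` all vanish (★ (P4) `exists_forall_mul_algebraMap_notMem`).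

Cell `hodgecm-mathlib`, ENGINE T1 (crux H413 = `stmt-HodgeConjecture-24833`), T1-qs road LAW 5, row
(L5-iii-b2) (b2-α′) «T-piece transfer `B → B_γ`» FILE 1 §2 (the `x`-line remainder; the `x`-fibre
identity and the assembly are FILE 2). HC_CM is proved only modulo the printed citations until rung 0
closes; this file is unconditional and touches no binder.

## References

* J. D. Rogawski, *Automorphic Representations of Unitary Groups in Three Variables*, Ann. of Math.
  Stud. 123 (1990), §7.2 (pp. 93–95) [Rogawski1990].
* J. Arthur, *A trace formula for reductive groups I*, Duke Math. J. 45 (1978), §8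
  [Arthur1978TraceFormulaI].
* A. Weil, *Adeles and algebraic groups* (1982), Chap. I n° 12 Lemme 5 [Weil1965].
* J. W. S. Cassels, A. Fröhlich (eds.), *Algebraic Number Theory* (1967), Ch. II §14, Ch. XV §4.1
  [CasselsFrohlichANT1967].
-/

set_option autoImplicit false

noncomputable section

open MeasureTheory Measure NumberField IsDedekindDomain Set Topology
open Literature.MeasureTheory.Group
open scoped NNReal ENNReal Pointwise

namespace Literature.NumberTheory.Automorphic

variable (K : Type) [Field K] [NumberField K]

/-! ## §1 Plumbing: the lattice `K ≤ 𝔸_K`, principal reindexing, dilation -/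

section Plumbing

/-- **`K` meets every compact subset of `𝔸_K` in finitely many points** (`K ≤ 𝔸_K` discrete and
closed; here read off the box count ★ `exists_ncard_mul_algebraMap_add_mem_le` at `λ = 1`, `s = 0`).
[cite: CasselsFrohlichANT1967, Ch. II §14 Theorem] -/
theorem finite_setOf_algebraMap_mem {C : Set (AdeleRing (𝓞 K) K)} (hC : IsCompact C) :
    {ξ : K | algebraMap K (AdeleRing (𝓞 K) K) ξ ∈ C}.Finite := by
  obtain ⟨c₁, -, h⟩ := exists_ncard_mul_algebraMap_add_mem_le K hC
  have h1 := (h 1 0).1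
  simpa only [Units.val_one, one_mul, add_zero] using h1

/-- The same for the principal subgroup `K ≤ 𝔸_K` as a subtype. [cite: CasselsFrohlichANT1967, Ch. II §14 Theorem] -/
theorem finite_setOf_principalSubgroup_mem {C : Set (AdeleRing (𝓞 K) K)} (hC : IsCompact C) :
    {l : AdeleRing.principalSubgroup (𝓞 K) K | (l : AdeleRing (𝓞 K) K) ∈ C}.Finite := by
  have hfin := finite_setOf_algebraMap_mem K hC
  have himg : {l : AdeleRing.principalSubgroup (𝓞 K) K | (l : AdeleRing (𝓞 K) K) ∈ C} ⊆
      (principalSubgroupEquiv K) '' {ξ : K | algebraMap K (AdeleRing (𝓞 K) K) ξ ∈ C} := by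
    intro l hl
    obtain ⟨ξ, rfl⟩ := (principalSubgroupEquiv K).surjective l
    exact ⟨ξ, hl, rfl⟩
  exact (hfin.image _).subset himg

/-- Sums over the principal subgroup are sums over `K`. [folklore] -/
private theorem tsum_principalSubgroup_eq {β : Type*} [AddCommMonoid β] [TopologicalSpace β]
    (g : AdeleRing (𝓞 K) K → β) :
    ∑' l : AdeleRing.principalSubgroup (𝓞 K) K, g (l : AdeleRing (𝓞 K) K) =
      ∑' ξ : K, g (algebraMap K (AdeleRing (𝓞 K) K) ξ) :=
  ((principalSubgroupEquiv K).tsum_eq fun l : AdeleRing.principalSubgroup (𝓞 K) K =>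
    g (l : AdeleRing (𝓞 K) K)).symm

omit [NumberField K] in
/-- **Principal reindexing**: multiplication by `r ∈ Kˣ` permutes `K`, so
`Σ_{ξ ∈ K} g(r ξ) = Σ_{ξ ∈ K} g(ξ)`. [folklore] -/
private theorem tsum_comp_units_mul {β : Type*} [AddCommMonoid β] [TopologicalSpace β]
    (r : Kˣ) (g : K → β) : ∑' ξ : K, g ((r : K) * ξ) = ∑' ξ : K, g ξ :=
  (Equiv.mulLeft₀ (r : K) r.ne_zero).tsum_eq g

variable [LocallyCompactSpace (AdeleRing (𝓞 K) K)] [MeasurableSpace (AdeleRing (𝓞 K) K)]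
  [BorelSpace (AdeleRing (𝓞 K) K)] (μ : Measure (AdeleRing (𝓞 K) K)) [μ.IsAddHaarMeasure] [μ.Regular]

/-- **Dilation and shift under an additive Haar measure**: `∫ F(a x + s) dμ(x) = ‖a‖⁻¹ ∫ F dμ` for an
idele `a` and an adele `s` (translation invariance and Tate's Lemma 4.1.2 `d(a x) = ‖a‖ dx`).
[cite: CasselsFrohlichANT1967, Ch. XV Lemma 4.1.2] -/
theorem integral_comp_units_mul_add {V : Type*} [NormedAddCommGroup V] [NormedSpace ℝ V]
    (a : (AdeleRing (𝓞 K) K)ˣ) (s : AdeleRing (𝓞 K) K) (F : AdeleRing (𝓞 K) K → V) :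
    ∫ x, F ((a : AdeleRing (𝓞 K) K) * x + s) ∂μ =
      ((IdeleClassGroup.ideleNorm K a : ℝ)⁻¹) • ∫ x, F x ∂μ := by
  have h1 : ∫ x, F ((a : AdeleRing (𝓞 K) K) * x + s) ∂μ =
      ∫ x, F ((a : AdeleRing (𝓞 K) K) * x) ∂μ := by
    have h := integral_add_right_eq_self (μ := μ)
      (fun x => F ((a : AdeleRing (𝓞 K) K) * x)) (((a⁻¹ : (AdeleRing (𝓞 K) K)ˣ) : AdeleRing (𝓞 K) K) * s)
    refine Eq.trans (integral_congr_ae (Filter.Eventually.of_forall fun x => ?_)) h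
    change F ((a : AdeleRing (𝓞 K) K) * x + s) =
      F ((a : AdeleRing (𝓞 K) K) * (x + ((a⁻¹ : (AdeleRing (𝓞 K) K)ˣ) : AdeleRing (𝓞 K) K) * s))
    rw [mul_add, ← mul_assoc, Units.mul_inv, one_mul]
  rw [h1]
  have h2 := integral_comp_smul_eq_distribHaarChar_inv_smul μ a F
  simp only [Units.smul_def, smul_eq_mul] at h2
  rw [h2, AdeleRing.distribHaarChar_eq_ideleNorm K a⁻¹, map_inv, NNReal.coe_inv]

/-- **`μ(a⁻¹ X) = ‖a‖⁻¹ μ(X)`**: the preimage of `X` under `x ↦ a x` has measure `‖a‖⁻¹ μ(X)`.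
[cite: CasselsFrohlichANT1967, Ch. XV Lemma 4.1.2] -/
theorem measure_preimage_units_mul (a : (AdeleRing (𝓞 K) K)ˣ) (X : Set (AdeleRing (𝓞 K) K)) :
    μ ((fun x : AdeleRing (𝓞 K) K => (a : AdeleRing (𝓞 K) K) * x) ⁻¹' X) =
      ((IdeleClassGroup.ideleNorm K a)⁻¹ : ℝ≥0) * μ X := by
  have hset : (fun x : AdeleRing (𝓞 K) K => (a : AdeleRing (𝓞 K) K) * x) ⁻¹' X =
      (a⁻¹ : (AdeleRing (𝓞 K) K)ˣ) • X := by
    ext x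
    rw [Set.mem_preimage, Set.mem_smul_set_iff_inv_smul_mem, inv_inv, Units.smul_def, smul_eq_mul]
  rw [hset, AdeleRing.addHaar_smul_eq_ideleNorm_mul K μ a⁻¹ X, map_inv, ENNReal.coe_inv
    (ideleNorm_ne_zero a)]

end Plumbing

/-! ## §2 The CUSP bound: lattice sum minus normalised integral ≤ oscillation × `‖a‖⁻¹` -/

section Cusp

variable [LocallyCompactSpace (AdeleRing (𝓞 K) K)] [MeasurableSpace (AdeleRing (𝓞 K) K)]
  [BorelSpace (AdeleRing (𝓞 K) K)] (μ : Measure (AdeleRing (𝓞 K) K)) [μ.IsAddHaarMeasure] [μ.Regular]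

omit [LocallyCompactSpace (AdeleRing (𝓞 K) K)] [MeasurableSpace (AdeleRing (𝓞 K) K)]
  [BorelSpace (AdeleRing (𝓞 K) K)] in
/-- Pointwise differences of compact subsets of `𝔸_K` are compact. [folklore] -/
private theorem isCompact_sub₇ {X Y : Set (AdeleRing (𝓞 K) K)} (hX : IsCompact X) (hY : IsCompact Y) :
    IsCompact (X - Y) := by
  rw [sub_eq_add_neg]; exact hX.add hY.neg

omit [LocallyCompactSpace (AdeleRing (𝓞 K) K)] [μ.Regular] in
/-- `μ(D) ≠ 0` for Tate's fundamental domain and an additive Haar measure (the translates `ξ + D`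
cover `𝔸_K`). [cite: CasselsFrohlichANT1967, Ch. XV Thm. 4.1.3] -/
private theorem measure_adeleFundamentalDomain_ne_zero' : μ (adeleFundamentalDomain K) ≠ 0 := by
  haveI : Countable (AdeleRing.principalSubgroup (𝓞 K) K) := by
    haveI : Countable K := Countable.of_equiv _ (Module.finBasis ℚ K).equivFun.toEquiv.symm
    exact (principalSubgroupEquiv K).countable_iff.1 inferInstance
  exact (isAddFundamentalDomain_adeleFundamentalDomain K μ).measure_ne_zero (NeZero.ne μ)

/-- **THE CUSP BOUND on the `x`-line.** Fix compacta `C_X, S₀, L₀ ⊆ 𝔸_K` and write `D` for Tate's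
fundamental domain. There is `D' ≥ 0` such that for every measurable `F : 𝔸_K → ℂ` vanishing off
`C_X` with `‖F‖ ≤ M`, every idele `a` and `r ∈ Kˣ` with `a · ι(r) ∈ L₀`, every `s ∈ S₀` and every
`ω ≥ 0` with `‖F(x) − F(x + a ι(r) v)‖ ≤ ω` for `v ∈ D`:
`‖Σ_{ξ ∈ K} F(a ξ + s) − μ(D)⁻¹ · ‖a‖⁻¹ · ∫ F dμ‖ ≤ ω · ‖a‖⁻¹ · D'` (Weil's Riemann-sum estimate ★
`norm_tsum_add_sub_smul_integral_le_of_isCompact` for `G(x) = F(a ι(r) x + s)` over the cells `ξ + D`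
of `K`, reindexing by `r`, `‖ι(r)‖ = 1`, `∫ G = ‖a‖⁻¹ ∫ F`, and `μ((a ι(r))⁻¹ Y) = ‖a‖⁻¹ μ(Y)`).
[cite: Rogawski1990, §7.2 (p. 95)] [cite: Weil1965, Chap. I n° 12 Lemme 5] [cite: Arthur1978TraceFormulaI, §8] -/
theorem exists_const_norm_tsum_line_sub_smul_integral_le
    {C_X S₀ L₀ : Set (AdeleRing (𝓞 K) K)} (hC : IsCompact C_X) (hS : IsCompact S₀)
    (hL : IsCompact L₀) :
    ∃ D' : ℝ, 0 ≤ D' ∧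
      ∀ (F : AdeleRing (𝓞 K) K → ℂ), Measurable F → (∀ x ∉ C_X, F x = 0) → ∀ M : ℝ, (∀ x, ‖F x‖ ≤ M) →
      ∀ (a : (AdeleRing (𝓞 K) K)ˣ) (r : Kˣ),
        (a : AdeleRing (𝓞 K) K) * algebraMap K (AdeleRing (𝓞 K) K) (r : K) ∈ L₀ →
      ∀ s ∈ S₀, ∀ ω : ℝ, 0 ≤ ω →
        (∀ x, ∀ v ∈ adeleFundamentalDomain K,
          ‖F x - F (x + (a : AdeleRing (𝓞 K) K) * algebraMap K (AdeleRing (𝓞 K) K) (r : K) * v)‖ ≤ ω) →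
        ‖(∑' ξ : K, F ((a : AdeleRing (𝓞 K) K) * algebraMap K (AdeleRing (𝓞 K) K) ξ + s)) -
            (((μ (adeleFundamentalDomain K)).toReal⁻¹ * ((IdeleClassGroup.ideleNorm K a : ℝ))⁻¹) •
              ∫ x, F x ∂μ)‖ ≤
          ω * ((IdeleClassGroup.ideleNorm K a : ℝ))⁻¹ * D' := by
  classical
  haveI : Countable K := Countable.of_equiv _ (Module.finBasis ℚ K).equivFun.toEquiv.symm
  haveI : Countable (AdeleRing.principalSubgroup (𝓞 K) K) :=
    (principalSubgroupEquiv K).countable_iff.1 inferInstance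
  -- the fundamental domain `P = D`
  set P : Set (AdeleRing (𝓞 K) K) := adeleFundamentalDomain K with hPdef
  have hP : IsAddFundamentalDomain (AdeleRing.principalSubgroup (𝓞 K) K) P μ :=
    isAddFundamentalDomain_adeleFundamentalDomain K μ
  have hPc : IsCompact (closure P) := isCompact_closure_adeleFundamentalDomain K
  have hP0 : μ P ≠ 0 := measure_adeleFundamentalDomain_ne_zero' K μ
  -- the compact `K₂ ⊇ e · (P̄ − ({0} ∪ P̄))` for `e ∈ L₀` and `Y = (C_X − S₀) + K₂`
  set Z : Set (AdeleRing (𝓞 K) K) := closure P - insert (0 : AdeleRing (𝓞 K) K) (closure P) with hZ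
  have hZc : IsCompact Z := isCompact_sub₇ K hPc (hPc.insert 0)
  set K₂ : Set (AdeleRing (𝓞 K) K) :=
    (fun p : AdeleRing (𝓞 K) K × AdeleRing (𝓞 K) K => p.1 * p.2) '' (L₀ ×ˢ Z) with hK₂
  have hK₂c : IsCompact K₂ := (hL.prod hZc).image (continuous_fst.mul continuous_snd)
  set Y : Set (AdeleRing (𝓞 K) K) := (C_X - S₀) + K₂ with hY
  refine ⟨(μ Y).toReal / (μ P).toReal, by positivity,
    fun F hFm hFC M hM a r haL s hs ω hω0 hω => ?_⟩
  -- the combined scaling `e = a ι(r)`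
  set e : (AdeleRing (𝓞 K) K)ˣ := a * principalIdele K r with hedef
  have he : (e : AdeleRing (𝓞 K) K) = (a : AdeleRing (𝓞 K) K) * algebraMap K (AdeleRing (𝓞 K) K) (r : K) := by
    rw [hedef, Units.val_mul]
    rfl
  have hnorm_e : IdeleClassGroup.ideleNorm K e = IdeleClassGroup.ideleNorm K a := by
    rw [hedef, map_mul, ideleNorm_principal ⟨r, rfl⟩, mul_one]
  -- the function `G(x) = F(e x + s)`
  set G : AdeleRing (𝓞 K) K → ℂ := fun x => F ((e : AdeleRing (𝓞 K) K) * x + s) with hGdef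
  have hGm : Measurable G := hFm.comp ((continuous_const.mul continuous_id).add continuous_const).measurable
  set C_G : Set (AdeleRing (𝓞 K) K) := (fun x => (e : AdeleRing (𝓞 K) K) * x + s) ⁻¹' C_X with hCG
  have hCGc : IsCompact C_G := by
    have hh : (fun x : AdeleRing (𝓞 K) K => (e : AdeleRing (𝓞 K) K) * x + s) =
        (Homeomorph.addRight s) ∘ (Homeomorph.smul e : AdeleRing (𝓞 K) K ≃ₜ AdeleRing (𝓞 K) K) := by
      funext x; rfl
    rw [hCG, hh, Set.preimage_comp]
    exact (Homeomorph.smul e).isCompact_preimage.2 ((Homeomorph.addRight s).isCompact_preimage.2 hC)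
  have hGC : ∀ x ∉ C_G, G x = 0 := fun x hx => hFC _ hx
  have hGbdd : ∀ x, ‖G x‖ ≤ M := fun x => hM _
  have hGi : Integrable G μ := by
    refine ⟨hGm.aestronglyMeasurable, ?_⟩
    refine IntegrableOn.integrable_of_forall_notMem_eq_zero (s := C_G) ?_ hGC |>.2
    exact Measure.integrableOn_of_bounded (M := M) hCGc.measure_lt_top.ne hGm.aestronglyMeasurable
      (ae_of_all _ fun x => hGbdd x)
  have hGω : ∀ x, ∀ v ∈ P, ‖G x - G (x + v)‖ ≤ ω := fun x v hv => by
    have h := hω ((e : AdeleRing (𝓞 K) K) * x + s) v hv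
    rw [hGdef]
    change ‖F ((e : AdeleRing (𝓞 K) K) * x + s) - F ((e : AdeleRing (𝓞 K) K) * (x + v) + s)‖ ≤ ω
    rw [mul_add, add_right_comm]
    rw [← he] at h
    exact h
  -- Weil's estimate
  obtain ⟨hfinG, hest⟩ := norm_tsum_add_sub_smul_integral_le_of_isCompact
    (AdeleRing.principalSubgroup (𝓞 K) K) (μ := μ)
    (fun C' hC' => finite_setOf_principalSubgroup_mem K hC') hP hP0 hPc hCGc hGi hGC hω0 hGω 0
  simp only [add_zero] at hfinG hest
  -- identify the pieces
  have hsumG : ∑' l : AdeleRing.principalSubgroup (𝓞 K) K, G (l : AdeleRing (𝓞 K) K) =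
      ∑' ξ : K, F ((a : AdeleRing (𝓞 K) K) * algebraMap K (AdeleRing (𝓞 K) K) ξ + s) := by
    rw [tsum_principalSubgroup_eq]
    have h1 : ∀ ξ : K, G (algebraMap K (AdeleRing (𝓞 K) K) ξ) =
        F ((a : AdeleRing (𝓞 K) K) * algebraMap K (AdeleRing (𝓞 K) K) ((r : K) * ξ) + s) := by
      intro ξ
      rw [hGdef]
      change F ((e : AdeleRing (𝓞 K) K) * algebraMap K (AdeleRing (𝓞 K) K) ξ + s) = _
      rw [he, map_mul, mul_assoc]
    simp_rw [h1]
    exact tsum_comp_units_mul K r fun ξ => F ((a : AdeleRing (𝓞 K) K) * algebraMap K (AdeleRing (𝓞 K) K) ξ + s)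
  have hint : ∫ x, G x ∂μ = ((IdeleClassGroup.ideleNorm K a : ℝ)⁻¹) • ∫ x, F x ∂μ := by
    rw [hGdef]
    change ∫ x, F ((e : AdeleRing (𝓞 K) K) * x + s) ∂μ = _
    rw [integral_comp_units_mul_add K μ e s F, hnorm_e]
  -- the measure of Weil's set
  have hYsub : (C_G - insert (0 : AdeleRing (𝓞 K) K) (closure P)) + closure P ⊆
      (fun x => (e : AdeleRing (𝓞 K) K) * x) ⁻¹' Y := by
    rintro _ ⟨_, ⟨g, hg, z, hz, rfl⟩, p, hp, rfl⟩
    have heL : (e : AdeleRing (𝓞 K) K) ∈ L₀ := by rw [he]; exact haL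
    refine ⟨(e : AdeleRing (𝓞 K) K) * g + s - s, sub_mem_sub hg hs, (e : AdeleRing (𝓞 K) K) * (p - z),
      ⟨((e : AdeleRing (𝓞 K) K), p - z), ⟨heL, sub_mem_sub hp hz⟩, rfl⟩, ?_⟩
    change (e : AdeleRing (𝓞 K) K) * g + s - s + (e : AdeleRing (𝓞 K) K) * (p - z) =
      (e : AdeleRing (𝓞 K) K) * (g - z + p)
    ring
  have hYm : μ ((C_G - insert (0 : AdeleRing (𝓞 K) K) (closure P)) + closure P) ≤
      ((IdeleClassGroup.ideleNorm K a)⁻¹ : ℝ≥0) * μ Y := by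
    refine (measure_mono hYsub).trans ?_
    rw [measure_preimage_units_mul K μ e Y, hnorm_e]
  have hYfin : μ Y < ∞ := ((isCompact_sub₇ K hC hS).add hK₂c).measure_lt_top
  have hPfin : μ P < ∞ := measure_adeleFundamentalDomain_lt_top K μ
  have hPpos : 0 < (μ P).toReal := ENNReal.toReal_pos hP0 hPfin.ne
  -- assemble
  have key : ‖(∑' ξ : K, F ((a : AdeleRing (𝓞 K) K) * algebraMap K (AdeleRing (𝓞 K) K) ξ + s)) -
      (((μ P).toReal⁻¹ * ((IdeleClassGroup.ideleNorm K a : ℝ))⁻¹) • ∫ x, F x ∂μ)‖ ≤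
      ω * ((μ ((C_G - insert (0 : AdeleRing (𝓞 K) K) (closure P)) + closure P)).toReal / (μ P).toReal) := by
    have h1 : (∑' ξ : K, F ((a : AdeleRing (𝓞 K) K) * algebraMap K (AdeleRing (𝓞 K) K) ξ + s)) -
        (((μ P).toReal⁻¹ * ((IdeleClassGroup.ideleNorm K a : ℝ))⁻¹) • ∫ x, F x ∂μ) =
        (∑' l : AdeleRing.principalSubgroup (𝓞 K) K, G (l : AdeleRing (𝓞 K) K)) -
          (μ P).toReal⁻¹ • ∫ x, G x ∂μ := by
      rw [hsumG, hint, smul_smul]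
    rw [h1]
    exact hest
  refine key.trans ?_
  rw [mul_assoc]
  refine mul_le_mul_of_nonneg_left ?_ hω0
  rw [← mul_div_assoc]
  refine div_le_div_of_nonneg_right ?_ hPpos.le
  have h := ENNReal.toReal_mono (ENNReal.mul_ne_top ENNReal.coe_ne_top hYfin.ne) hYm
  rwa [ENNReal.toReal_mul, ENNReal.coe_toReal, NNReal.coe_inv] at h

end Cusp

/-! ## §3 The COUNT bound: `O(max(1, ‖a‖⁻¹))` terms, every shift -/

section Count

/-- **THE COUNT BOUND on the `x`-line.** For compact `C_X ⊆ 𝔸_K` there is `c₁ > 0` such that for every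
`F : 𝔸_K → V` vanishing off `C_X` with `‖F‖ ≤ M`, every idele `a` and EVERY adele `s`: the lattice sum
`Σ_{ξ ∈ K} F(a ξ + s)` has finitely many non-zero terms (hence converges) and
`‖Σ_{ξ ∈ K} F(a ξ + s)‖ ≤ M · c₁ · max(1, ‖a‖⁻¹)` (★ box count `exists_ncard_mul_algebraMap_add_mem_le`).
[cite: Rogawski1990, §7.2 (p. 95)] [cite: CasselsFrohlichANT1967, Ch. II §14 Theorem] -/
theorem exists_const_summable_norm_tsum_line_le {V : Type*} [NormedAddCommGroup V]
    {C_X : Set (AdeleRing (𝓞 K) K)} (hC : IsCompact C_X) :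
    ∃ c₁ : ℝ, 0 < c₁ ∧ ∀ (F : AdeleRing (𝓞 K) K → V), (∀ x ∉ C_X, F x = 0) → ∀ M : ℝ, (∀ x, ‖F x‖ ≤ M) →
      ∀ (a : (AdeleRing (𝓞 K) K)ˣ) (s : AdeleRing (𝓞 K) K),
        Summable (fun ξ : K => F ((a : AdeleRing (𝓞 K) K) * algebraMap K (AdeleRing (𝓞 K) K) ξ + s)) ∧
        ‖∑' ξ : K, F ((a : AdeleRing (𝓞 K) K) * algebraMap K (AdeleRing (𝓞 K) K) ξ + s)‖ ≤
          M * (c₁ * max 1 ((IdeleClassGroup.ideleNorm K a : ℝ))⁻¹) := by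
  classical
  obtain ⟨c₁, hc₁, hcount⟩ := exists_ncard_mul_algebraMap_add_mem_le K hC
  refine ⟨c₁, hc₁, fun F hFC M hM a s => ?_⟩
  obtain ⟨hfin, hle⟩ := hcount a s
  set S : Set K := {t : K | (a : AdeleRing (𝓞 K) K) * algebraMap K (AdeleRing (𝓞 K) K) t + s ∈ C_X} with hS
  have hM0 : 0 ≤ M := (norm_nonneg _).trans (hM 0)
  -- the summand vanishes off the finite set `S`
  have hzero : ∀ ξ ∉ hfin.toFinset, F ((a : AdeleRing (𝓞 K) K) * algebraMap K (AdeleRing (𝓞 K) K) ξ + s) = 0 := by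
    intro ξ hξ
    rw [Set.Finite.mem_toFinset] at hξ
    exact hFC _ hξ
  refine ⟨summable_of_ne_finset_zero hzero, ?_⟩
  rw [tsum_eq_sum hzero]
  calc ‖∑ ξ ∈ hfin.toFinset, F ((a : AdeleRing (𝓞 K) K) * algebraMap K (AdeleRing (𝓞 K) K) ξ + s)‖
      ≤ ∑ ξ ∈ hfin.toFinset, ‖F ((a : AdeleRing (𝓞 K) K) * algebraMap K (AdeleRing (𝓞 K) K) ξ + s)‖ :=
        norm_sum_le _ _
    _ ≤ ∑ ξ ∈ hfin.toFinset, M := Finset.sum_le_sum fun ξ _ => hM _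
    _ = (hfin.toFinset.card : ℝ) * M := by rw [Finset.sum_const, nsmul_eq_mul]
    _ = (S.ncard : ℝ) * M := by rw [Set.ncard_eq_toFinset_card S hfin]
    _ ≤ (c₁ * max 1 ((IdeleClassGroup.ideleNorm K a : ℝ))⁻¹) * M :=
        mul_le_mul_of_nonneg_right hle hM0
    _ = M * (c₁ * max 1 ((IdeleClassGroup.ideleNorm K a : ℝ))⁻¹) := mul_comm _ _

end Count

/-! ## §4 The LOW regime: the terms `ξ ≠ 0` vanish for `‖a‖` large -/

section Low

/-- **THE LOW REGIME on the `x`-line.** For compacta `C_X, S₀ ⊆ 𝔸_K` there is `c₀ ≥ 0` such that for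
every idele `a` with `c₀ < ‖a‖`, every `s ∈ S₀`, every `F` vanishing off `C_X` and every `ξ ∈ Kˣ`:
`F(a ξ + s) = 0` (★ escape `exists_forall_mul_algebraMap_notMem` for the compact `C_X − S₀`); so the
`ξ ≠ 0` part of the lattice sum vanishes identically. [cite: Rogawski1990, §7.2 (p. 95)]
[cite: CasselsFrohlichANT1967, Ch. II §16 Theorem (product formula)] -/
theorem exists_forall_apply_units_mul_add_eq_zero {V : Type*} [Zero V]
    {C_X S₀ : Set (AdeleRing (𝓞 K) K)} (hC : IsCompact C_X) (hS : IsCompact S₀) :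
    ∃ c₀ : ℝ, 0 ≤ c₀ ∧ ∀ (a : (AdeleRing (𝓞 K) K)ˣ), c₀ < (IdeleClassGroup.ideleNorm K a : ℝ) →
      ∀ s ∈ S₀, ∀ (F : AdeleRing (𝓞 K) K → V), (∀ x ∉ C_X, F x = 0) →
        ∀ ξ : Kˣ, F ((a : AdeleRing (𝓞 K) K) * algebraMap K (AdeleRing (𝓞 K) K) (ξ : K) + s) = 0 := by
  have hCS : IsCompact (C_X - S₀) := by rw [sub_eq_add_neg]; exact hC.add hS.neg
  obtain ⟨c₀, hc₀, h⟩ := exists_forall_mul_algebraMap_notMem K hCS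
  refine ⟨c₀, hc₀, fun a ha s hs F hFC ξ => hFC _ fun hmem => ?_⟩
  exact h a ha ξ ⟨_, hmem, s, hs, add_sub_cancel_right _ _⟩

/-- `tsum` form of the LOW regime: for `c₀ < ‖a‖` and `s ∈ S₀`,
`Σ_{ξ ∈ Kˣ} F(a ξ + s) = 0`. [cite: Rogawski1990, §7.2 (p. 95)] -/
theorem exists_forall_tsum_units_line_eq_zero {V : Type*} [AddCommMonoid V] [TopologicalSpace V]
    {C_X S₀ : Set (AdeleRing (𝓞 K) K)} (hC : IsCompact C_X) (hS : IsCompact S₀) :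
    ∃ c₀ : ℝ, 0 ≤ c₀ ∧ ∀ (a : (AdeleRing (𝓞 K) K)ˣ), c₀ < (IdeleClassGroup.ideleNorm K a : ℝ) →
      ∀ s ∈ S₀, ∀ (F : AdeleRing (𝓞 K) K → V), (∀ x ∉ C_X, F x = 0) →
        ∑' ξ : Kˣ, F ((a : AdeleRing (𝓞 K) K) * algebraMap K (AdeleRing (𝓞 K) K) (ξ : K) + s) = 0 := by
  obtain ⟨c₀, hc₀, h⟩ := exists_forall_apply_units_mul_add_eq_zero (V := V) K hC hS
  refine ⟨c₀, hc₀, fun a ha s hs F hFC => ?_⟩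
  simp_rw [h a ha s hs F hFC]
  exact tsum_zero

end Low

end Literature.NumberTheory.Automorphic
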